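import Summits.QuantumFields.YangMills.Theorems.TwistEaterVolumeQuadraticGrowthQuaternion
import HarnessLib

/-!
# The EXACT structure of SU(2) twist-eaters in the quaternion model
# (layer (B1b), algebraic half, of the DIRECT Laplace road to ⟨stmt-QuantumFields-24204⟩ `VirialFluxGap.SharpTwistedLaplace`)

Helper module (free-hands work of width seat ym-line-sfw-p2-w2 g49, cell ym-idea-1).  The zero set of the twisted ring deficit is, in comb
gauge, the set of quadruples `(c; w₀, w₁, w₂)` of `SU(2) ≅` unit quaternions with `[w_i, w_j] = 1` and `c w_k c⁻¹ = ε_k w_k`, `ε_k = −1` on the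
twisted directions (✓`ringDeficit_eq_zero_iff` + comb gauge).  fcl-p3's ✓`exists_twisted_solution_near` is the STABILITY of these relations; this
file records their EXACT SOLUTION SET (the `η = 0` case made explicit):

★ `twistEater_structure` — if unit quaternions `a, u_k` satisfy `u_i u_j = u_j u_i`, `a u_k = −u_k a` for twisted `k` (at least one, `k₀`) and
`a u_k = u_k a` for untwisted `k`, then `a` and `u_{k₀}` are PURE with orthogonal imaginary parts, every twisted `u_k` equals `±u_{k₀}`, and every
untwisted `u_k` equals `±1`.  Consequently (`twistEater_of_signs` for the converse) for a fixed pure orthonormal pair the solutions are indexed by sign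
patterns — `2^{#twisted}·2^{#untwisted} = 8` quadruples, i.e. `4` classes modulo the simultaneous sign flip of the twisted members
(conjugation by `a`), in agreement with HEARTS g15-A §1 («exactly 4 conjugacy classes», there supported numerically).

Everything here is PROVED; no definitions, no named facts.  HONEST FRAMING: elementary algebra in `ℍ`; ⟨24204⟩, ⟨24319⟩ and every rung
stay OPEN; the Yang–Mills mass gap (Clay) is NOT touched; no summit is proved by a line.
-/

set_option autoImplicit false

noncomputable section

open scoped Quaternion

namespace Summit.QuantumFields.YangMills.Theorems.QuantitativeLaplace

open Summit.QuantumFields.YangMills.Theorems.ToronValleyVolume.Lojasiewicz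
open Summit.QuantumFields.YangMills.Theorems.TwistEaterVolume.Quadratic

/-! ## §1 Exact anticommutation and commutation of unit quaternions -/

/-- Three real squares summing to zero vanish. [folklore] -/
theorem eq_zero_of_sq_add_sq_add_sq_eq_zero {x y z : ℝ} (h : x ^ 2 + y ^ 2 + z ^ 2 = 0) : x = 0 ∧ y = 0 ∧ z = 0 := by
  have hx : x ^ 2 = 0 := by nlinarith [sq_nonneg x, sq_nonneg y, sq_nonneg z]
  have hy : y ^ 2 = 0 := by nlinarith [sq_nonneg x, sq_nonneg y, sq_nonneg z]
  have hz : z ^ 2 = 0 := by nlinarith [sq_nonneg x, sq_nonneg y, sq_nonneg z]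
  exact ⟨pow_eq_zero_iff (n := 2) (by norm_num) |>.mp hx, pow_eq_zero_iff (n := 2) (by norm_num) |>.mp hy,
    pow_eq_zero_iff (n := 2) (by norm_num) |>.mp hz⟩

/-- `d² = 1 ⇒ d = 1 ∨ d = −1`. [folklore] -/
theorem eq_one_or_eq_neg_one_of_sq_eq_one {d : ℝ} (h : d ^ 2 = 1) : d = 1 ∨ d = -1 := by
  rw [sq] at h
  exact mul_self_eq_one_iff.mp h

/-- An EXACTLY anticommuting pair of unit quaternions is a pair of PURE quaternions with orthogonal imaginary parts. [folklore] -/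
theorem pure_of_anticomm {a u : ℍ} (ha : ‖a‖ = 1) (hu : ‖u‖ = 1) (h : a * u = -(u * a)) :
    a.re = 0 ∧ u.re = 0 ∧ a.imI * u.imI + a.imJ * u.imJ + a.imK * u.imK = 0 := by
  have h0 : ‖a * u + u * a‖ ≤ 0 := by rw [h, neg_add_cancel, norm_zero]
  obtain ⟨h1, h2, h3⟩ := sq_le_of_anticomm ha hu h0
  have e1 : a.re ^ 2 = 0 := le_antisymm (by simpa using h1) (sq_nonneg _)
  have e2 : u.re ^ 2 = 0 := le_antisymm (by simpa using h2) (sq_nonneg _)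
  have e3 : (a.imI * u.imI + a.imJ * u.imJ + a.imK * u.imK) ^ 2 = 0 := le_antisymm (by simpa using h3) (sq_nonneg _)
  exact ⟨pow_eq_zero_iff (n := 2) (by norm_num) |>.mp e1, pow_eq_zero_iff (n := 2) (by norm_num) |>.mp e2,
    pow_eq_zero_iff (n := 2) (by norm_num) |>.mp e3⟩

/-- The squared norm of the imaginary part of a pure unit quaternion is `1`. [folklore] -/
theorem imDot_eq_one_of_pure {u : ℍ} (hu : ‖u‖ = 1) (hure : u.re = 0) :
    u.imI * u.imI + u.imJ * u.imJ + u.imK * u.imK = 1 := by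
  have := norm_sq_eq_re_sq_add_imDot u
  rw [hu, hure] at this
  linarith [this]

/-- Two EXACTLY commuting PURE unit quaternions are equal or opposite. [folklore] -/
theorem eq_or_eq_neg_of_comm_of_pure {u v : ℍ} (hu : ‖u‖ = 1) (hv : ‖v‖ = 1) (hure : u.re = 0) (hvre : v.re = 0)
    (h : u * v = v * u) : u = v ∨ u = -v := by
  have hc := cross_sq_le_of_comm u v (η := 0) (by rw [h, sub_self, norm_zero])
  have hu1 := imDot_eq_one_of_pure hu hure
  have hv1 := imDot_eq_one_of_pure hv hvre
  rw [hu1, hv1] at hc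
  set d : ℝ := u.imI * v.imI + u.imJ * v.imJ + u.imK * v.imK with hd
  have hd1 : 1 ≤ d ^ 2 := by linarith [hc]
  have hlag := lagrange₃ u.imI u.imJ u.imK v.imI v.imJ v.imK
  rw [hu1, hv1, ← hd] at hlag
  have hle : d ^ 2 ≤ 1 := by
    nlinarith [hlag, sq_nonneg (u.imJ * v.imK - u.imK * v.imJ), sq_nonneg (u.imK * v.imI - u.imI * v.imK),
      sq_nonneg (u.imI * v.imJ - u.imJ * v.imI)]
  have hd2 : d ^ 2 = 1 := le_antisymm hle hd1
  rcases eq_one_or_eq_neg_one_of_sq_eq_one hd2 with hp | hm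
  · left
    have hs : (u.imI - v.imI) ^ 2 + (u.imJ - v.imJ) ^ 2 + (u.imK - v.imK) ^ 2 = 0 := by nlinarith [hu1, hv1, hp, hd]
    obtain ⟨e1, e2, e3⟩ := eq_zero_of_sq_add_sq_add_sq_eq_zero hs
    have e1' : u.imI = v.imI := by linarith
    have e2' : u.imJ = v.imJ := by linarith
    have e3' : u.imK = v.imK := by linarith
    ext <;> simp [hure, hvre, e1', e2', e3']
  · right
    have hs : (u.imI + v.imI) ^ 2 + (u.imJ + v.imJ) ^ 2 + (u.imK + v.imK) ^ 2 = 0 := by nlinarith [hu1, hv1, hm, hd]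
    obtain ⟨e1, e2, e3⟩ := eq_zero_of_sq_add_sq_add_sq_eq_zero hs
    have e1' : u.imI = -v.imI := by linarith
    have e2' : u.imJ = -v.imJ := by linarith
    have e3' : u.imK = -v.imK := by linarith
    rw [eq_neg_iff_add_eq_zero]
    ext <;> simp [hure, hvre, e1', e2', e3']

/-- If `Im u ∥ Im a` exactly (`|Im u|²|Im a|² = (Im u·Im a)²` with `|Im a| = 1`) then `Im u = (Im u·Im a)·Im a`. [folklore] -/
theorem im_eq_smul_of_parallel {u a : ℍ} (ha1 : a.imI * a.imI + a.imJ * a.imJ + a.imK * a.imK = 1)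
    (h : (u.imI * u.imI + u.imJ * u.imJ + u.imK * u.imK) * (a.imI * a.imI + a.imJ * a.imJ + a.imK * a.imK) -
      (u.imI * a.imI + u.imJ * a.imJ + u.imK * a.imK) ^ 2 ≤ 0) :
    u.imI = (u.imI * a.imI + u.imJ * a.imJ + u.imK * a.imK) * a.imI ∧
      u.imJ = (u.imI * a.imI + u.imJ * a.imJ + u.imK * a.imK) * a.imJ ∧
      u.imK = (u.imI * a.imI + u.imJ * a.imJ + u.imK * a.imK) * a.imK := by
  set p : ℝ := u.imI * a.imI + u.imJ * a.imJ + u.imK * a.imK with hp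
  have hA : (u.imI - p * a.imI) ^ 2 + (u.imJ - p * a.imJ) ^ 2 + (u.imK - p * a.imK) ^ 2 =
      (u.imI * u.imI + u.imJ * u.imJ + u.imK * u.imK) - p ^ 2 := by
    have : (u.imI - p * a.imI) ^ 2 + (u.imJ - p * a.imJ) ^ 2 + (u.imK - p * a.imK) ^ 2 =
        (u.imI * u.imI + u.imJ * u.imJ + u.imK * u.imK) - 2 * p * (u.imI * a.imI + u.imJ * a.imJ + u.imK * a.imK) +
          p ^ 2 * (a.imI * a.imI + a.imJ * a.imJ + a.imK * a.imK) := by ring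
    rw [this, ha1, ← hp]; ring
  rw [ha1, mul_one] at h
  have h0 : (u.imI - p * a.imI) ^ 2 + (u.imJ - p * a.imJ) ^ 2 + (u.imK - p * a.imK) ^ 2 = 0 :=
    le_antisymm (by rw [hA]; exact h) (by positivity)
  obtain ⟨e1, e2, e3⟩ := eq_zero_of_sq_add_sq_add_sq_eq_zero h0
  exact ⟨by linarith, by linarith, by linarith⟩

/-- A unit quaternion commuting EXACTLY with two pure unit quaternions whose imaginary parts are orthogonal is `±1`. [folklore] -/
theorem eq_one_or_neg_one_of_comm_pair {a n u : ℍ} (ha : ‖a‖ = 1) (hn : ‖n‖ = 1) (hu : ‖u‖ = 1) (hare : a.re = 0) (hnre : n.re = 0)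
    (hperp : a.imI * n.imI + a.imJ * n.imJ + a.imK * n.imK = 0) (hca : u * a = a * u) (hcn : u * n = n * u) :
    u = 1 ∨ u = -1 := by
  have ha1 := imDot_eq_one_of_pure ha hare
  have hn1 := imDot_eq_one_of_pure hn hnre
  have h04 : (0 : ℝ) ^ 2 / 4 = 0 := by norm_num
  have hpa := cross_sq_le_of_comm u a (η := 0) (by rw [hca, sub_self, norm_zero])
  have hpn := cross_sq_le_of_comm u n (η := 0) (by rw [hcn, sub_self, norm_zero])
  rw [h04] at hpa hpn
  obtain ⟨e1, e2, e3⟩ := im_eq_smul_of_parallel ha1 hpa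
  obtain ⟨f1, f2, f3⟩ := im_eq_smul_of_parallel hn1 hpn
  set p : ℝ := u.imI * a.imI + u.imJ * a.imJ + u.imK * a.imK with hp
  set q : ℝ := u.imI * n.imI + u.imJ * n.imJ + u.imK * n.imK with hq
  -- `|Im u|² = p q (Im a · Im n) = 0`
  have hV : u.imI * u.imI + u.imJ * u.imJ + u.imK * u.imK = 0 := by
    linear_combination u.imI * f1 + u.imJ * f2 + u.imK * f3 + (q * n.imI) * e1 + (q * n.imJ) * e2 + (q * n.imK) * e3 +
      p * q * hperp
  have hV' : u.imI ^ 2 + u.imJ ^ 2 + u.imK ^ 2 = 0 := by linear_combination hV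
  obtain ⟨i1, i2, i3⟩ := eq_zero_of_sq_add_sq_add_sq_eq_zero hV'
  have hre : u.re ^ 2 = 1 := by
    have := norm_sq_eq_re_sq_add_imDot u
    rw [hu, i1, i2, i3] at this
    linarith
  rcases eq_one_or_eq_neg_one_of_sq_eq_one hre with h | h
  · left; ext <;> simp [h, i1, i2, i3]
  · right
    rw [eq_neg_iff_add_eq_zero]
    ext <;> simp [h, i1, i2, i3]

/-! ## §2 The structure theorem -/

/-- ★ **The exact structure of SU(2) twist-eaters.**  Unit quaternions `a; u₀, u₁, u₂` with `u_i u_j = u_j u_i`, `a u_k = −u_k a` for the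
twisted directions `ε k = true` (at least one, `k₀`) and `a u_k = u_k a` for the untwisted ones: then `a` and `u_{k₀}` are pure with orthogonal
imaginary parts, every twisted `u_k` is `±u_{k₀}`, and every untwisted `u_k` is `±1`. [folklore] -/
theorem twistEater_structure (a : ℍ) (u : Fin 3 → ℍ) (ε : Fin 3 → Bool) (k₀ : Fin 3) (hk₀ : ε k₀ = true)
    (ha : ‖a‖ = 1) (hu : ∀ k, ‖u k‖ = 1) (hcomm : ∀ i j, u i * u j = u j * u i)
    (htw : ∀ k, ε k = true → a * u k = -(u k * a)) (hun : ∀ k, ε k = false → a * u k = u k * a) :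
    a.re = 0 ∧ (u k₀).re = 0 ∧ a.imI * (u k₀).imI + a.imJ * (u k₀).imJ + a.imK * (u k₀).imK = 0 ∧
      (∀ k, ε k = true → u k = u k₀ ∨ u k = -(u k₀)) ∧ (∀ k, ε k = false → u k = 1 ∨ u k = -1) := by
  obtain ⟨hare, hu0re, hperp⟩ := pure_of_anticomm ha (hu k₀) (htw k₀ hk₀)
  refine ⟨hare, hu0re, hperp, fun k hk => ?_, fun k hk => ?_⟩
  · obtain ⟨-, hkre, -⟩ := pure_of_anticomm ha (hu k) (htw k hk)
    exact eq_or_eq_neg_of_comm_of_pure (hu k) (hu k₀) hkre hu0re (hcomm k k₀)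
  · exact eq_one_or_neg_one_of_comm_pair ha (hu k₀) (hu k) hare hu0re hperp (hun k hk).symm (hcomm k k₀)

/-- Conversely, every sign pattern on a pure orthonormal pair IS a twist-eater: with `u_k = s_k • n` (twisted) ∕ `u_k = s_k • 1`
(untwisted), `s_k = ±1`, the relations hold. [folklore] -/
theorem twistEater_of_signs {a n : ℍ} (hare : a.re = 0) (hnre : n.re = 0)
    (hperp : a.imI * n.imI + a.imJ * n.imJ + a.imK * n.imK = 0) (ε : Fin 3 → Bool) (s : Fin 3 → ℝ)
    (u : Fin 3 → ℍ) (hu : ∀ k, u k = s k • (if ε k then n else (1 : ℍ))) :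
    (∀ i j, u i * u j = u j * u i) ∧ (∀ k, ε k = true → a * u k = -(u k * a)) ∧ (∀ k, ε k = false → a * u k = u k * a) := by
  have han : a * n = -(n * a) := pure_mul_pure_eq_neg hare hnre hperp
  have hb : ∀ i j, (if ε i then n else (1 : ℍ)) * (if ε j then n else (1 : ℍ)) =
      (if ε j then n else (1 : ℍ)) * (if ε i then n else (1 : ℍ)) := by
    intro i j
    split_ifs <;> simp
  refine ⟨fun i j => ?_, fun k hk => ?_, fun k hk => ?_⟩
  · rw [hu i, hu j, smul_mul_assoc, mul_smul_comm, smul_mul_assoc, mul_smul_comm, hb i j, smul_comm]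
  · rw [hu k, if_pos hk, mul_smul_comm, han, smul_neg, smul_mul_assoc]
  · have hk' : ¬ (ε k = true) := by simp [hk]
    rw [hu k, if_neg hk', mul_smul_comm, mul_one, smul_mul_assoc, one_mul]

end Summit.QuantumFields.YangMills.Theorems.QuantitativeLaplace
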